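import Summits.AtomisticToContinuum.HydrodynamicLimit.Theorems.InformationPercolationEnginePercolationClosesChaosDockingReplace
import Literature.MathematicalPhysics.KineticTheory.HardSphereOrbitVariation
import HarnessLib

/-!
# Docking S7 of the line `equilibrium-forecast-chain-rule` (crux `InformationPercolationEngine.PercolationClosesChaos`,
stmt-AtomisticToContinuum-15178) — piece F1: in-step path lengths of the good-row triples against the conserved energy

Support file (`--supports stmt-AtomisticToContinuum-15178`) of the registered stub
`stub_docking : KineticCellChaosLG → NoMesoscopicOscillation → LocalCountUI → ContactChaos` (worker S7 of lead c3).
The per-collision replacement of piece B (`abs_dockSummand_sub_dockMain_le`) charges a collision triple `(s, i, j)` of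
step `k` the in-step path length `stepPath i = ∫_{kΔ}^{(k+1)Δ} ‖v_i(u)‖ du` of its first member. Summed over the triples
of the step whose first member starts in a cell with row count `≤ T₂` (the GOOD ROWS; a sphere starting there has at
most `(n̄c) T₂` collisions in the step, `card_filter_fst_le_rowCount`), these path lengths are controlled by the conserved
kinetic energy with a Cauchy–Schwarz gain:

* `sum_mul_stepPath_le`: `Σ_i m_i · stepPath i ≤ Δ √(Σ_i m_i²) √(2E(z))` on a good orbit (exchange the finite sum and the
  time integral, the weighted Cauchy–Schwarz `Σ_i m_i ‖v_i‖ ≤ √(Σ_i m_i²) √(2E)` over the spheres at each time — Literature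
  `sum_mul_norm_vel_le_sqrt` of `HardSphereOrbitVariation` —, and `E(Φ_u z) = E(z)` by `HardSphereFlow.configEnergy_flow`);
* `sum_stepPath_good_le` (registered helper F1): with `m_i` the number of good-row triples with first member `i`
  (`m_i ≤ (n̄c) T₂`, `Σ_i m_i ≤ #triples`),
  `Σ_{good-row triples e} stepPath e.2.1 ≤ Δ · √((n̄c) T₂ · #triples) · √(2E(z))`.

Elementary (GST 2013 §4.1: piecewise free flight; CIP 1994 §4.2: conservation of energy); the time-integrability of the
speed along a good orbit is `HardSphereFlow.intervalIntegrable_norm_vel_flow` (Literature `HardSphereDisplacementPathLength`).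
-/

noncomputable section

open MeasureTheory Set Filter Topology
open scoped ENNReal BigOperators Classical
open Literature.Analysis.FluidPDE Literature.MathematicalPhysics.KineticTheory
open Literature.MathematicalPhysics.KineticTheory.VelocityBlindPlacement

namespace Summit.AtomisticToContinuum.HydrodynamicLimit.Theorems.EquilibriumForecastLine

/-- **Weighted in-step path lengths against the conserved energy.** On a good orbit, for any weights `m_i`,
`Σ_i m_i · stepPath i ≤ Δ · √(Σ_i m_i²) · √(2E(z))`: exchange the sum and the time integral, Cauchy–Schwarz over the
spheres at each time, `E(Φ_u z) = E(z)`. [folklore] -/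
theorem sum_mul_stepPath_le {σ : ℝ} {N : ℕ} (Φ : Flow σ N) {z : Phase N} (hz : z ∈ Φ.good) {c : ℝ} (hc : 0 < c)
    (hσ : 0 < σ) (k : ℕ) (m : Fin (N + 1) → ℝ) :
    ∑ i, m i * stepPath c σ N Φ k z i ≤
      stepLen c σ N * (Real.sqrt (∑ i, m i ^ 2) * Real.sqrt (2 * configEnergy z)) := by
  set Δ := stepLen c σ N with hΔdef
  set a : ℝ := (k : ℝ) * Δ with ha
  set b : ℝ := ((k : ℝ) + 1) * Δ with hb
  have hΔ : 0 < Δ := stepLen_pos hc hσ N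
  have hab : a ≤ b := by rw [ha, hb]; nlinarith
  have hba : b - a = Δ := by rw [ha, hb]; ring
  have hint : ∀ i ∈ (Finset.univ : Finset (Fin (N + 1))),
      IntervalIntegrable (fun u => m i * ‖(Φ.flow u z i).2‖) volume a b :=
    fun i _ => (Φ.intervalIntegrable_norm_vel_flow hz i a b).const_mul (m i)
  -- each weighted path length is the interval integral of the weighted speed
  have hstep : ∀ i, m i * stepPath c σ N Φ k z i = ∫ u in a..b, m i * ‖(Φ.flow u z i).2‖ := by
    intro i
    rw [intervalIntegral.integral_const_mul]
    rfl
  simp_rw [hstep]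
  rw [← intervalIntegral.integral_finsetSum hint]
  have hsum : IntervalIntegrable (fun u => ∑ i, m i * ‖(Φ.flow u z i).2‖) volume a b := by
    have hfn : (fun u => ∑ i, m i * ‖(Φ.flow u z i).2‖) = ∑ i, fun u => m i * ‖(Φ.flow u z i).2‖ := by
      funext u
      simp only [Finset.sum_apply]
    rw [hfn]
    exact IntervalIntegrable.sum Finset.univ hint
  -- Cauchy–Schwarz at each time and conservation of energy, then integrate the constant
  have h := intervalIntegral.integral_mono_on hab hsum intervalIntegrable_const
    (g := fun _ => Real.sqrt (∑ i, m i ^ 2) * Real.sqrt (2 * configEnergy z)) fun u _ => by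
      have h1 := sum_mul_norm_vel_le_sqrt m (Φ.flow u z)
      rwa [Φ.configEnergy_flow hz u] at h1
  rwa [intervalIntegral.integral_const, smul_eq_mul, hba] at h

/-- **Registered helper `sum_stepPath_good_le` (piece F1 of the docking S7): the in-step path lengths of the good-row
triples against the conserved energy.** On a good orbit, summing `stepPath` of the first member over the collision triples
of step `k` whose first member starts in a cell of row count `≤ T₂`,
`Σ stepPath ≤ Δ · √((n̄c) T₂ · #(triples of the step)) · √(2E(z))`: regroup by first member with multiplicities
`m_i ≤ (n̄c) · rowCount (startCell i) ≤ (n̄c) T₂` (`card_filter_fst_le_rowCount`), `Σ_i m_i ≤ #triples`, so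
`Σ_i m_i² ≤ (n̄c) T₂ · #triples`, and `sum_mul_stepPath_le`. [folklore] -/
theorem sum_stepPath_good_le : ∀ {σ : ℝ} {N : ℕ} (Φ : Flow σ N) {z : Phase N}, z ∈ Φ.good → ∀ {c : ℝ}, 0 < c → 0 < σ → ∀ (k : ℕ) {T₂ : ℝ}, 0 ≤ T₂ → ∑ e ∈ (collTriples Φ (stepWindow c σ N k) z).filter (fun e => rowCount c σ N Φ k (startCell c σ N Φ k z e.2.1) z ≤ T₂), stepPath c σ N Φ k z e.2.1 ≤ stepLen c σ N * (Real.sqrt ((cellCount c σ N * c) * T₂ * ((collTriples Φ (stepWindow c σ N k) z).card : ℝ)) * Real.sqrt (2 * configEnergy z)) := by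
  intro σ N Φ z hz c hc hσ k T₂ hT₂
  set T := collTriples Φ (stepWindow c σ N k) z with hT
  set G := T.filter (fun e => rowCount c σ N Φ k (startCell c σ N Φ k z e.2.1) z ≤ T₂) with hG
  have hnc : 0 ≤ cellCount c σ N * c := (mul_pos (cellCount_pos hc hσ N) hc).le
  -- multiplicities of the first members among the good-row triples
  set m : Fin (N + 1) → ℝ := fun i => ((G.filter fun e => e.2.1 = i).card : ℝ) with hm
  have hm0 : ∀ i, 0 ≤ m i := fun i => Nat.cast_nonneg _
  -- regroup the sum by first member
  have hregroup : ∑ e ∈ G, stepPath c σ N Φ k z e.2.1 = ∑ i, m i * stepPath c σ N Φ k z i := by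
    rw [← Finset.sum_fiberwise_of_maps_to (g := fun e : ℝ × Fin (N + 1) × Fin (N + 1) => e.2.1)
      (t := Finset.univ) (fun e _ => Finset.mem_univ _)]
    refine Finset.sum_congr rfl fun i _ => ?_
    rw [Finset.sum_congr rfl fun e he => by rw [(Finset.mem_filter.1 he).2], Finset.sum_const, nsmul_eq_mul]
  -- each multiplicity is at most `(n̄c) T₂`
  have hmle : ∀ i, m i ≤ cellCount c σ N * c * T₂ := by
    intro i
    by_cases h0 : (G.filter fun e => e.2.1 = i).Nonempty
    · obtain ⟨e, he⟩ := h0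
      have heG := (Finset.mem_filter.1 he).1
      have hei : e.2.1 = i := (Finset.mem_filter.1 he).2
      have hrow : rowCount c σ N Φ k (startCell c σ N Φ k z i) z ≤ T₂ := by
        rw [← hei]; exact (Finset.mem_filter.1 heG).2
      have hsub : (G.filter fun e => e.2.1 = i) ⊆ T.filter fun e => e.2.1 = i :=
        Finset.filter_subset_filter _ (Finset.filter_subset _ T)
      calc m i ≤ ((T.filter fun e => e.2.1 = i).card : ℝ) := by
            show (((G.filter fun e => e.2.1 = i).card : ℕ) : ℝ) ≤ _
            exact_mod_cast Finset.card_le_card hsub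
        _ ≤ cellCount c σ N * c * rowCount c σ N Φ k (startCell c σ N Φ k z i) z :=
            card_filter_fst_le_rowCount Φ hz hc hσ k i
        _ ≤ cellCount c σ N * c * T₂ := mul_le_mul_of_nonneg_left hrow hnc
    · rw [Finset.not_nonempty_iff_eq_empty] at h0
      have : m i = 0 := by simp only [hm, h0, Finset.card_empty, Nat.cast_zero]
      rw [this]; positivity
  -- the multiplicities add up to `#G ≤ #T`
  have hmsum : ∑ i, m i ≤ (T.card : ℝ) := by
    have h1 : ∑ i, m i = (G.card : ℝ) := by
      rw [hm]
      simp only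
      rw [← Nat.cast_sum, ← Finset.card_eq_sum_card_fiberwise fun e _ => Finset.mem_univ (e.2.1)]
    rw [h1]
    exact_mod_cast Finset.card_le_card (Finset.filter_subset _ T)
  have hm2 : ∑ i, m i ^ 2 ≤ cellCount c σ N * c * T₂ * (T.card : ℝ) := by
    calc ∑ i, m i ^ 2 ≤ ∑ i, cellCount c σ N * c * T₂ * m i := Finset.sum_le_sum fun i _ => by
          rw [sq]; exact mul_le_mul_of_nonneg_right (hmle i) (hm0 i)
      _ = cellCount c σ N * c * T₂ * ∑ i, m i := (Finset.mul_sum _ _ _).symm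
      _ ≤ _ := mul_le_mul_of_nonneg_left hmsum (by positivity)
  rw [hregroup]
  refine (sum_mul_stepPath_le Φ hz hc hσ k m).trans ?_
  have hΔ : 0 < stepLen c σ N := stepLen_pos hc hσ N
  gcongr

end Summit.AtomisticToContinuum.HydrodynamicLimit.Theorems.EquilibriumForecastLine

end
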